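import Literature.Analysis.FluidPDE.TypeIAncientMild
import Literature.Analysis.FluidPDE.KNSSSmoothingHolds
import Literature.Analysis.FluidPDE.SelfSimilar
import HarnessLib

/-!
# Route PlaneEnergyCeiling · crux `BoundedPlanarEnergyRegularity` — zoom stub, step 5:
# a bounded continuous Oseen-mild ancient field is a smooth bounded ancient mild solution

Helper file for the crux item stmt-NavierStokesRegularity-16921 (`BoundedPlanarEnergyRegularity`),
serving the zoom stub `stub_planarEnergyZoom` (= support item stmt-NavierStokesRegularity-16858) of
its line `birth`. For the pointwise zoom limit `v` of `exists_zoom_limit_of_memLp_two` /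
`zoom_limit_oseen_identity` — continuous on `ℝ × ℝ³`, bounded by `2` on `t ≤ 0`, weakly
divergence-free slices, and the Oseen integral equation `v(t) = e^{(t−s)Δ}v(s) − B¹_s(v,v)(t)` for
all `s < t < 0` — we prove (`zoom_limit_isBoundedAncientMildSolution`):

* `v` is a **bounded ancient mild solution** in the duality sense of `SelfSimilar.lean`
  (`IsBoundedAncientMildSolution 1 v`): the two-time duality identity follows from the Oseen
  equation exactly as in `IsTypeIAncientMild.isMildNSSolutionBetween` (`TypeIAncientMild.lean`;
  Lemarié-Rieusset 2016, Thm. 6.1, (6.12) ⇒ (6.11); KNSS 2009, Rem. 4.1), with the bound `2` in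
  place of the Type I bound;
* `v` is **jointly smooth** on `(−∞, 0) × ℝ³` (KNSS 2009, Prop. 4.1: the Oseen right-hand side of a
  bounded mild solution is `C^∞`, the tree's `knss2009_smoothing_holds`, and `v` coincides with it
  on every `(s, 0) × ℝ³`);
* the slices are measurable (continuity).

Also: weak divergence-freeness passes to bounded pointwise limits of continuous fields
(`isWeaklyDivFree_of_tendsto_of_bound`, dominated convergence against `∇θ`).

References: Koch–Nadirashvili–Seregin–Šverák 2009, §4 Prop. 4.1 and Rem. 4.1, §6 (arXiv:0709.3599);
Lemarié-Rieusset 2016, Thm. 6.1. [KochNadirashviliSereginSverak2009] [LemarieRieusset2016]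
-/

noncomputable section

-- single-conjunct summit: `Summit.<Summit>.<Problem>` repeats the name by the D-0017 layout
set_option linter.dupNamespace false

namespace Summit.NavierStokesRegularity.NavierStokesRegularity.Theorems.BoundedPlanarEnergyRegularity

open MeasureTheory Set Function Filter Topology TopologicalSpace Metric
open scoped NNReal ENNReal RealInnerProductSpace
open Literature.Analysis Literature.Analysis.FluidPDE

/-- **Weak divergence-freeness passes to bounded pointwise limits of continuous fields**: if
continuous fields `a n`, uniformly bounded, weakly divergence free, converge pointwise to `aL`,
then `aL` is weakly divergence free (dominated convergence in `∫ ⟪a n, ∇θ⟫ = 0`). -/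
theorem isWeaklyDivFree_of_tendsto_of_bound
    {a : ℕ → EuclideanSpace ℝ (Fin 3) → EuclideanSpace ℝ (Fin 3)}
    {aL : EuclideanSpace ℝ (Fin 3) → EuclideanSpace ℝ (Fin 3)} (ha : ∀ n, IsWeaklyDivFree (a n))
    (hac : ∀ n, Continuous (a n)) {M : ℝ} (hM : ∀ n x, ‖a n x‖ ≤ M)
    (hlim : ∀ x, Tendsto (fun n => a n x) atTop (𝓝 (aL x))) : IsWeaklyDivFree aL := by
  intro θ hθ
  have hgrad : FunctionSpaces.IsTestFunctionOn (⊤ : Opens (EuclideanSpace ℝ (Fin 3))) (gradient θ) := by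
    refine ⟨?_, ?_, by simp⟩
    · exact (InnerProductSpace.toDual ℝ (EuclideanSpace ℝ (Fin 3))).symm.contDiff.comp
        (hθ.contDiff.fderiv_right (m := (⊤ : ℕ∞)) (by exact_mod_cast le_top))
    · exact (hθ.hasCompactSupport.fderiv (𝕜 := ℝ)).comp_left
        (g := fun L => (InnerProductSpace.toDual ℝ (EuclideanSpace ℝ (Fin 3))).symm L) (by simp)
  have hgc : Continuous (gradient θ) := hgrad.contDiff.continuous
  have hgs : HasCompactSupport (gradient θ) := hgrad.hasCompactSupport
  have hM0 : 0 ≤ M := (norm_nonneg _).trans (hM 0 0)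
  have hconv : Tendsto (fun n => ∫ x, ⟪a n x, gradient θ x⟫) atTop (𝓝 (∫ x, ⟪aL x, gradient θ x⟫)) := by
    refine tendsto_integral_of_dominated_convergence (fun x => M * ‖gradient θ x‖)
      (fun n => ((hac n).inner hgc).aestronglyMeasurable) ?_ ?_ ?_
    · exact (hgc.norm.const_mul M).integrable_of_hasCompactSupport (hgs.norm.mul_left)
    · intro n
      refine Eventually.of_forall fun x => ?_
      calc ‖⟪a n x, gradient θ x⟫‖ ≤ ‖a n x‖ * ‖gradient θ x‖ := norm_inner_le_norm _ _
        _ ≤ M * ‖gradient θ x‖ := mul_le_mul_of_nonneg_right (hM n x) (norm_nonneg _)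
    · exact Eventually.of_forall fun x => ((hlim x).inner tendsto_const_nhds)
  have h0 : ∀ n, ∫ x, ⟪a n x, gradient θ x⟫ = 0 := fun n => ha n θ hθ
  simp_rw [h0] at hconv
  exact tendsto_nhds_unique hconv tendsto_const_nhds ▸ rfl

-- the duality step adapted from Literature/Analysis/FluidPDE/TypeIAncientMild.lean
-- (IsTypeIAncientMild.isMildNSSolutionBetween)
/-- **A bounded continuous Oseen-mild ancient field is a smooth bounded ancient mild solution**
(module docstring): for `v` continuous on `ℝ × ℝ³`, bounded by `2` on `t ≤ 0`, with weakly
divergence-free slices for `t < 0` and the Oseen integral equation between all `s < t < 0`,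
`v` is a bounded ancient mild solution (`ν = 1`, duality form), jointly `C^∞` on `(−∞,0) × ℝ³`
(KNSS 2009, Prop. 4.1, `knss2009_smoothing_holds`), with measurable slices. -/
theorem zoom_limit_isBoundedAncientMildSolution :
    ∀ (v : ℝ → EuclideanSpace ℝ (Fin 3) → EuclideanSpace ℝ (Fin 3)),
      Continuous (Function.uncurry v) → (∀ t ≤ 0, ∀ x, ‖v t x‖ ≤ 2) →
      (∀ t < 0, Literature.Analysis.FluidPDE.IsWeaklyDivFree (v t)) →
      (∀ (s t : ℝ) (x : EuclideanSpace ℝ (Fin 3)), s < t → t < 0 →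
        v t x = Literature.Analysis.UnboundedOperators.heatExtension (v s) (t - s) x -
          Literature.Analysis.FluidPDE.oseenDuhamel 1 s v v t x) →
      Literature.Analysis.FluidPDE.IsBoundedAncientMildSolution 1 v ∧
      ContDiffOn ℝ (⊤ : ℕ∞) (Function.uncurry v) (Set.Iio 0 ×ˢ Set.univ) ∧
      (∀ t < 0, MeasureTheory.AEStronglyMeasurable (v t) MeasureTheory.volume) := by
  intro v hvcont hvbd hdiv hmild
  have hslice : ∀ t, Continuous (v t) := fun t =>
    hvcont.comp (Continuous.prodMk_right t)
  have hmeas_slice : ∀ t, AEStronglyMeasurable (v t) volume := fun t =>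
    (hslice t).aestronglyMeasurable
  have hmeas : ∀ s T : ℝ, AEStronglyMeasurable (uncurry v)
      ((volume : Measure (ℝ × EuclideanSpace ℝ (Fin 3))).restrict (Ioo s T ×ˢ univ)) := fun s T =>
    hvcont.aestronglyMeasurable
  -- ### the two-time duality identity
  have hduality : ∀ s t : ℝ, s < t → t < 0 → IsMildNSSolutionBetween 1 0 v s t := by
    intro s t hst ht φ hφ hφdiv
    have hs : s < 0 := hst.trans ht
    have huM : ∀ τ ∈ Ioo s t, ∀ y, ‖v τ y‖ ≤ 2 := fun τ hτ y => hvbd τ (hτ.2.trans ht).le y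
    have hφc : Continuous φ := hφ.contDiff.continuous
    -- the three tested identities
    have hB := integral_inner_oseenDuhamel_eq_neg_intervalIntegral one_pos (hmeas s t) zero_le_two
      huM hst le_rfl hφ hφdiv
    have hA := integral_inner_heatExtension_comm_of_bound (hmeas_slice s)
      (fun x => hvbd s hs.le x) hφc hφ.hasCompactSupport (sub_pos.2 hst)
    have hut : ∀ x, v t x =
        UnboundedOperators.heatExtension (v s) (t - s) x - oseenDuhamel 1 s v v t x :=
      fun x => hmild s t x hst ht
    -- integrability of the three pairings
    obtain ⟨K, -, hK⟩ := exists_norm_oseenDuhamel_bounded_le (E := EuclideanSpace ℝ (Fin 3))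
    have hiB : Integrable (fun x => ⟪oseenDuhamel 1 s v v t x, φ x⟫)
        (volume : Measure (EuclideanSpace ℝ (Fin 3))) :=
      integrable_inner_of_norm_le_of_hasCompactSupport
        (aestronglyMeasurable_oseenDuhamel one_pos (hmeas s t) (hmeas s t) zero_le_two huM huM hst
          le_rfl)
        (fun x => hK one_pos hst zero_le_two huM huM x) hφc hφ.hasCompactSupport
    have hiU : Integrable (fun x => ⟪v t x, φ x⟫) (volume : Measure (EuclideanSpace ℝ (Fin 3))) :=
      integrable_inner_of_continuous_of_hasCompactSupport (hslice t) hφc hφ.hasCompactSupport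
    have hiA : Integrable
        (fun x => ⟪UnboundedOperators.heatExtension (v s) (t - s) x, φ x⟫)
        (volume : Measure (EuclideanSpace ℝ (Fin 3))) := by
      refine (hiU.add hiB).congr (Eventually.of_forall fun x => ?_)
      simp only [Pi.add_apply, hut x, inner_sub_left, sub_add_cancel]
    -- assemble
    calc ∫ x, ⟪v t x, φ x⟫
        = ∫ x, (⟪UnboundedOperators.heatExtension (v s) (t - s) x, φ x⟫ -
            ⟪oseenDuhamel 1 s v v t x, φ x⟫) := by
          refine integral_congr_ae (Eventually.of_forall fun x => ?_)
          simp only [hut x, inner_sub_left]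
      _ = (∫ x, ⟪UnboundedOperators.heatExtension (v s) (t - s) x, φ x⟫) -
            ∫ x, ⟪oseenDuhamel 1 s v v t x, φ x⟫ := integral_sub hiA hiB
      _ = (∫ x, ⟪v s x, heatTest 1 φ (t - s) x⟫) +
            (∫ τ in s..t, ∫ x, ⟪v τ x, convect (v τ) (heatTest 1 φ (t - τ)) x⟫) +
            ∫ τ in s..t, ∫ x, ⟪(0 : ℝ → EuclideanSpace ℝ (Fin 3) → EuclideanSpace ℝ (Fin 3)) τ x,
              heatTest 1 φ (t - τ) x⟫ := by
          rw [hA, hB, heatTest_of_pos one_pos (sub_pos.2 hst), one_mul]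
          simp
  -- ### smoothness on the open slab (KNSS Prop 4.1)
  have hsmooth : ContDiffOn ℝ (⊤ : ℕ∞) (uncurry v) (Iio 0 ×ˢ univ) := by
    have hloc : ∀ s < (0 : ℝ), ContDiffOn ℝ (⊤ : ℕ∞) (uncurry v) (Ioo s 0 ×ˢ univ) := by
      intro s hs
      have htop : ∀ t ∈ Ioo s 0, eLpNorm (v t) ∞ volume ≤ ENNReal.ofReal 2 := by
        intro t ht
        rw [eLpNorm_exponent_top]
        exact eLpNormEssSup_le_of_ae_bound (Eventually.of_forall fun x => hvbd t ht.2.le x)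
      have hs_top : eLpNorm (v s) ∞ volume ≤ ENNReal.ofReal 2 := by
        rw [eLpNorm_exponent_top]
        exact eLpNormEssSup_le_of_ae_bound (Eventually.of_forall fun x => hvbd s hs.le x)
      have hae : ∀ t ∈ Ioo s 0, v t =ᵐ[volume] fun x =>
          UnboundedOperators.heatExtension (v s) (1 * (t - s)) x - oseenDuhamel 1 s v v t x := by
        intro t ht
        refine Eventually.of_forall fun x => ?_
        rw [one_mul]
        exact hmild s t x ht.1 ht.2
      obtain ⟨hS, -, -⟩ := knss2009_smoothing_holds (EuclideanSpace ℝ (Fin 3)) one_pos hs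
        zero_le_two (hmeas_slice s) hs_top (hmeas s 0) htop hae
      refine (hS : ContDiffOn ℝ (⊤ : ℕ∞) _ _).congr ?_
      rintro ⟨t, x⟩ ⟨ht, -⟩
      show v t x = UnboundedOperators.heatExtension (v s) (1 * (t - s)) x - oseenDuhamel 1 s v v t x
      rw [one_mul]
      exact hmild s t x ht.1 ht.2
    refine contDiffOn_of_locally_contDiffOn fun z hz => ?_
    obtain ⟨hz1, -⟩ := hz
    refine ⟨Ioo (z.1 - 1) 0 ×ˢ univ, isOpen_Ioo.prod isOpen_univ, ⟨⟨by linarith, hz1⟩, mem_univ _⟩, ?_⟩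
    have hsub : (Iio (0 : ℝ) ×ˢ (univ : Set (EuclideanSpace ℝ (Fin 3)))) ∩ Ioo (z.1 - 1) 0 ×ˢ univ ⊆
        Ioo (z.1 - 1) 0 ×ˢ univ := inter_subset_right
    exact (hloc (z.1 - 1) (by linarith [show z.1 < 0 from hz1])).mono hsub
  refine ⟨⟨⟨hdiv, fun s t hst ht => hduality s t hst ht⟩, ⟨2, fun t ht x => hvbd t (le_of_lt ht) x⟩⟩,
    hsmooth, fun t _ => hmeas_slice t⟩

end Summit.NavierStokesRegularity.NavierStokesRegularity.Theorems.BoundedPlanarEnergyRegularity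

end
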